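import Summits.RiemannHypothesis.RiemannHypothesis.Theorems.Splittings.RobinFiniteSqrtWindowBoxes
import HarnessLib

/-!
# RobinFiniteSqrtWindowCells — gen 16 «Q-SCALE √-WINDOW LIFTS THE LEVEL BUDGETS», part 2/5: the `√`-window rational cell checker and its soundness

Cell rh-split, seat rh-split-robin-finite g16 (card `cards/SPLIT-robin-finite.md` §23).

THE LEVER (gen 16).  The landed cell certificates (`RobinAnalyticSharp.cover11 … cover17`, budgets `b₁₁ … b₁₇ = 0.105 … 0.50`) price the
SECOND prime `Q` with Schoenfeld's RH-form relative error `δ(Q) = log²Q/(8π√Q)` two-sided.  Büthe 2018 Thm 2 (`Buthe2018_thm2_theta`,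
already a hypothesis of every low-height row) gives the ONE-SIDED `√`-window `y − 1.95√y ≤ θ(y) ≤ y` (`1423 ≤ y ≤ 10¹⁹`):
`δ_l(Q) = 1.95/√Q`, `δ_u = 0`, `δ(P) ↦ 0`.  Re-certifying the SAME covers (`coverOKS`, `decide +kernel`) lifts the budgets to
`b'₁₁ … b'₁₇ = 0.208, 0.332, 0.405, 0.461, 0.504, 0.538, 0.564`; Büthe 2016 and the range condition drop out below `10¹⁹`.
Rows (RH(T) in hypothesis position): `RH(10⁵) ⟹ robinCA_below 55 000 001`; `4¹³ ← RH(124 000)`, `4¹⁴ ← RH(212 000)`,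
`4¹⁵ ← RH(364 000)`, `4¹⁶ ← RH(705 000)`, `4¹⁷ ← RH(1.4·10⁶)`, `4¹⁸ ← RH(2.65·10⁶)` (tree: —, 330 000, 500 000, 860 000, 1.62·10⁶, 3·10⁶).

HONEST LABEL: SPLITTING SEARCH over kernel-typed RH-EQUIVALENCES; a splitting A ∧ B ⟹ RH is CONDITIONAL
bookkeeping unless A and B are both proved; nothing here bears on the truth of RH.

This part (12 `def`, 8 theorems): S4 `dS`, `kappaS`, `cRS`, `g2BoxS`, `g1BoxS`, `cellCheckS`, `kappaFirstS`, `g2BoxFirstS`, `cellCheckFirstS`, `dT`, `checkTailS`, `coverOKS`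
(plain functions of the tree's `Cell` / `Anchor` records; interior cells with `1423 ≤ n₁` take `d = 39/(20 r₁) ≥ 1.95/√n₁`, else the tree's `d1`;
the first cell keeps `(d599, 0)`), the casts, `kappaFirstS_nonneg`, `one_le_theta_ofW`, `sqrtWindow_lower`, `cell_soundS`, `cell_soundFirstS`.
-/

set_option linter.dupNamespace false

noncomputable section

open Real Filter Finset
open scoped Chebyshev

namespace Summit.RiemannHypothesis.RiemannHypothesis.Theorems.Splittings.RobinFiniteC1

open Literature.NumberTheory.LFunctions Literature.NumberTheory.DiophantineGeometry
open RobinAnalyticSharp RobinAnalyticSharp.Cells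
open Summit.RiemannHypothesis.RiemannHypothesis.Theorems.Splittings.RobinFiniteE3

section SqrtWindowCells

/-! ### S4 · the `√`-window cell certificate

Same `Cell` / `Anchor` data and the same landed covers; new rational boxes.  Per cell: `dS = 1.95/r₁` (`r₁² ≤ n₁`, so
`dS ≥ 1.95/√Q` on the cell) when `n₁ ≥ 1423`, else the Schoenfeld-form `d1`; `κS = (1 − dS)·ℓ₁/(ℓ₁ + 1) − dS` (upper error
`0`); `cRS = 1 + a₂/s₁` (`θ(P) ≤ P`, `θ(Q) ≤ Q`).  First cell at `Q' = 599` with `(d599, 0)`; tail with `dT = 1.95/r`,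
`θP + θQ ≤ 2P`. -/

/-- `√`-window relative lower error of a cell. -/
def dS (c : Cell) : ℚ := if 1423 ≤ c.A₁.n then 39 / (20 * c.A₁.r) else c.d1
/-- `√`-window `κ`. -/
def kappaS (c : Cell) : ℚ := (1 - (dS c)) * (c.ell1 / (c.ell1 + 1)) - (dS c)
/-- `√`-window `cR` (`δ(P) ↦ 0`, `δ_u(Q) ↦ 0`). -/
def cRS (c : Cell) : ℚ := 1 + c.a2 / s1 c.k
/-- `√`-window `G₂` box. -/
def g2BoxS (c : Cell) : ℚ := (kappaS c) * c.mlow - 1 / s1 c.k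
/-- `√`-window `G₁` box. -/
def g1BoxS (c : Cell) : ℚ := (1 - (dS c)) * c.a1 / ((cRS c) * (1 + ((cRS c) - 1) / L1 c.k))
/-- Cell check at budget `b` against the `√`-window boxes (the landed structural check `c.check` is kept verbatim). -/
def cellCheckS (b : ℚ) (c : Cell) : Bool :=
  c.check && decide ((dS c) ≤ 1 / 2) && decide (0 ≤ (kappaS c)) && decide (eBoxEbQ b c.k c.p16 < (g1BoxS c) + (g2BoxS c))
/-- First-cell `κ` at `Q' = 599`: lower error `d599`, upper error `0`. -/
def kappaFirstS : ℚ := (1 - d599) * (ell599 / (ell599 + 1)) - d599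
/-- First-cell `G₂` box. -/
def g2BoxFirstS (c : Cell) : ℚ := kappaFirstS * c.mlow - 1 / s1 c.k
/-- First-cell check at budget `b` (must pass with `G₂` alone). -/
def cellCheckFirstS (b : ℚ) (c : Cell) : Bool :=
  c.checkFirst && decide (eBoxEbQ b c.k c.p16 < (g2BoxFirstS c))
/-- Tail lower error `1.95/r`. -/
def dT (A : Anchor) : ℚ := 39 / (20 * A.r)
/-- Tail check at budget `b` (`G₁` alone, `θP + θQ ≤ 2P`). -/
def checkTailS (b : ℚ) (k : ℕ) (A : Anchor) (p16 : ℚ) : Bool :=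
  checkTail k A p16 && decide (1423 ≤ A.n) && decide ((dT A) ≤ 1 / 2)
    && decide (eBoxEbQ b k p16 < (1 - (dT A)) * (A.n / 2 ^ k) / (2 * (1 + 1 / L1 k)))
/-- The full check of a `P`-level at budget `b` against the `√`-window (shape of `coverOKB`). -/
def coverOKS (b : ℚ) (k : ℕ) (l : List Cell) (T : Anchor) (p16 : ℚ) : Bool :=
  match l with
  | [] => false
  | c₀ :: _ => cellCheckFirstS b c₀ && decide (599 ≤ c₀.A₂.n) && decide (1423 ≤ T.n)
      && l.all (fun c => cellCheckS b c && (c.k == k)) && chainOK l && (lastN l == T.n)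
      && checkTailS b k T p16

/-- Cast of the `G₂` box. -/
theorem g2BoxS_cast (c : Cell) :
    (((g2BoxS c) : ℚ) : ℝ) = g2BoxA ((dS c) : ℝ) 0 (c.ell1 : ℝ) (c.mlow : ℝ) (s1 c.k : ℝ) := by
  simp only [g2BoxS, kappaS, g2BoxA]; push_cast; ring

/-- Cast of the `G₁` box. -/
theorem g1BoxS_cast (c : Cell) :
    (((g1BoxS c) : ℚ) : ℝ) = g1Box ((dS c) : ℝ) (c.a1 : ℝ) ((cRS c) : ℝ) (L1 c.k : ℝ) := by
  simp only [g1BoxS, g1Box]; push_cast; ring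

/-- Cast of the first-cell box. -/
theorem g2BoxFirstS_cast (c : Cell) :
    (((g2BoxFirstS c) : ℚ) : ℝ) = g2BoxA (d599 : ℝ) 0 (ell599 : ℝ) (c.mlow : ℝ) (s1 c.k : ℝ) := by
  simp only [g2BoxFirstS, kappaFirstS, g2BoxA]; push_cast; ring

/-- `0 ≤ κ_first` (a closed rational). -/
theorem kappaFirstS_nonneg : (0 : ℝ) ≤ (1 - ((d599 : ℚ) : ℝ)) * (((ell599 : ℚ) : ℝ) / (((ell599 : ℚ) : ℝ) + 1)) - (((d599 : ℚ) : ℝ) + 0) := by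
  have h : (0 : ℚ) ≤ kappaFirstS := by decide +kernel
  have h' : (0 : ℝ) ≤ ((kappaFirstS : ℚ) : ℝ) := by exact_mod_cast h
  simp only [kappaFirstS] at h'; push_cast at h'; linarith

/-- `1 ≤ θ(P)` for `599 ≤ P ≤ B` on the two-sided window. -/
theorem one_le_theta_ofW {B : ℝ} (hW : ∀ y : ℝ, 599 ≤ y → y ≤ B → |θ y - y| ≤ √y * Real.log y ^ 2 / (8 * π))
    {P : ℝ} (hP : 599 ≤ P) (hPB : P ≤ B) : 1 ≤ θ P := by
  obtain ⟨hl, -⟩ := theta_two_sidedW hW hP le_rfl hPB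
  have hδ := schoenfeldDelta_le hP
  have : (1 - 0.0666) * 599 ≤ (1 - schoenfeldDelta P) * P :=
    mul_le_mul (by linarith) hP (by norm_num) (by linarith [schoenfeldDelta_nonneg P])
  linarith

/-- The `√`-window lower error on `[Q, P]`: for `1423 ≤ Q`, `θ(t) ≥ t − 1.95√t ≥ (1 − 1.95/√Q)·t` on `[Q, P] ⊆ [1423, B]`. -/
theorem sqrtWindow_lower {B : ℝ} (hLo : ∀ y : ℝ, 1423 ≤ y → y ≤ B → y - 1.95 * √y ≤ θ y) {Q P : ℝ}
    (hQ : 1423 ≤ Q) (hPB : P ≤ B) : ∀ t ∈ Set.Icc Q P, (1 - 1.95 / √Q) * t ≤ θ t := by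
  intro t ht
  have hQ0 : 0 < Q := by linarith
  have hsQ0 : 0 < √Q := Real.sqrt_pos.2 hQ0
  have htQ : Q ≤ t := ht.1
  have ht0 : 0 < t := by linarith
  have hlo := hLo t (hQ.trans htQ) (ht.2.trans hPB)
  have hst : √Q ≤ √t := Real.sqrt_le_sqrt htQ
  have htt : √t * √t = t := Real.mul_self_sqrt ht0.le
  have key : √t ≤ t / √Q := by
    rw [le_div_iff₀ hsQ0]
    calc √t * √Q ≤ √t * √t := mul_le_mul_of_nonneg_left hst (Real.sqrt_nonneg _)
      _ = t := htt
  calc (1 - 1.95 / √Q) * t = t - 1.95 * (t / √Q) := by ring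
    _ ≤ t - 1.95 * √t := by linarith [key]
    _ ≤ θ t := hlo

/-- **Soundness of `cellCheckS`**: `Eb b P < G₂ + G₁` on the cell, for `599 ≤ Q`, given the two-sided Schoenfeld-form window,
Büthe's lower `√`-window on `[1423, B]` and `θ(y) ≤ y` on `[1, B]`. -/
theorem cell_soundS {B : ℝ} (hW : ∀ y : ℝ, 599 ≤ y → y ≤ B → |θ y - y| ≤ √y * Real.log y ^ 2 / (8 * π))
    (hLo : ∀ y : ℝ, 1423 ≤ y → y ≤ B → y - 1.95 * √y ≤ θ y)
    (hUp : ∀ y : ℝ, 1 ≤ y → y ≤ B → θ y ≤ y)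
    {b : ℚ} (hb0 : (0 : ℝ) ≤ b) (hb2 : (b : ℝ) ≤ 2.042)
    (c : Cell) (hc : cellCheckS b c = true) {P Q : ℕ} (hPl : 4 ^ c.k ≤ P) (hPu : P ≤ 4 ^ (c.k + 1))
    (hPB : (P : ℝ) ≤ B) (hQ : 599 ≤ Q) (hQP : Q ≤ P)
    (hQ₁ : (c.A₁.n : ℝ) * √(P : ℝ) ≤ (Q : ℝ) * 2 ^ c.k)
    (hQ₂ : (Q : ℝ) * 2 ^ c.k ≤ (c.A₂.n : ℝ) * √(P : ℝ)) :
    (nicolasERH P + ((b : ℝ) - nicolasBeta) * (1 / (√P * Real.log P) + 1 / (√P * Real.log P ^ 2) + 4 / (√P * Real.log P ^ 3))) <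
      ∑ p ∈ (Nat.primesLE P).filter (fun p => Q < p), ((p : ℝ) ^ 2)⁻¹ +
        θ Q / ((θ P + θ Q) * Real.log (θ P + θ Q)) := by
  simp only [cellCheckS, Bool.and_eq_true, decide_eq_true_eq] at hc
  obtain ⟨⟨⟨hc, hdS1⟩, hκS⟩, hcellB⟩ := hc
  simp only [Cell.check, Bool.and_eq_true, Bool.or_eq_true, decide_eq_true_eq] at hc
  obtain ⟨⟨⟨⟨⟨⟨⟨⟨⟨⟨hA₁, hA₂⟩, hn⟩, hk⟩, hp0⟩, hp6⟩, -⟩, hell0⟩, -⟩, hla⟩, -⟩ := hc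
  obtain ⟨hP₁599, hL₁, hU₁, hL₂, hL₁8, hs₁, hs₁0⟩ := range_facts hk
  have hPl' : (4 : ℝ) ^ c.k ≤ P := by exact_mod_cast hPl
  have hPu' : (P : ℝ) ≤ (4 : ℝ) ^ (c.k + 1) := by exact_mod_cast hPu
  have h2k : (0 : ℝ) < 2 ^ c.k := by positivity
  have hQr : (599 : ℝ) ≤ Q := by exact_mod_cast hQ
  have hQPr : (Q : ℝ) ≤ P := by exact_mod_cast hQP
  have hQ0 : (0 : ℝ) < Q := by linarith
  have hP599 : (599 : ℝ) ≤ P := hQr.trans hQPr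
  have hP0 : (0 : ℝ) < P := by linarith
  have hsP : (2 : ℝ) ^ c.k ≤ √(P : ℝ) := by rw [← sqrt_four_pow]; exact Real.sqrt_le_sqrt hPl'
  -- `a₁`, `a₂`, `n₁ ≤ Q`
  have ha₁ : ((c.a1 : ℚ) : ℝ) * √(P : ℝ) ≤ Q := by
    simp only [Cell.a1]; push_cast
    rw [div_mul_eq_mul_div, div_le_iff₀ h2k]; exact hQ₁
  have ha₂ : (Q : ℝ) ≤ ((c.a2 : ℚ) : ℝ) * √(P : ℝ) := by
    simp only [Cell.a2]; push_cast
    rw [div_mul_eq_mul_div, le_div_iff₀ h2k]; exact hQ₂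
  have ha₁0 : (0 : ℝ) ≤ ((c.a1 : ℚ) : ℝ) := by simp only [Cell.a1]; push_cast; positivity
  have hn₂ : (1 : ℝ) ≤ c.A₂.n := by exact_mod_cast (Nat.succ_le_of_lt (lt_of_le_of_lt (Nat.zero_le _) hn))
  have ha₂0 : (0 : ℝ) < ((c.a2 : ℚ) : ℝ) := by simp only [Cell.a2]; push_cast; positivity
  have hn₁Q : (c.A₁.n : ℝ) ≤ Q := by
    have h1 : (c.A₁.n : ℝ) * 2 ^ c.k ≤ (c.A₁.n : ℝ) * √(P : ℝ) :=
      mul_le_mul_of_nonneg_left hsP (Nat.cast_nonneg _)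
    exact le_of_mul_le_mul_right (h1.trans hQ₁) h2k
  -- `θ`-facts at `P` and `Q`
  have hθPu : θ (P : ℝ) ≤ (1 + 0) * (P : ℝ) := by
    rw [add_zero, one_mul]; exact hUp P (by linarith) hPB
  have hθQu : θ (Q : ℝ) ≤ (1 + 0) * (Q : ℝ) := by
    rw [add_zero, one_mul]; exact hUp Q (by linarith) (hQPr.trans hPB)
  have hθP1 : 1 ≤ θ (P : ℝ) := one_le_theta_ofW hW hP599 hPB
  -- the lower error `δl ≤ dS` with its pointwise bound on `[Q, P]`
  have hdS1r : (((dS c) : ℚ) : ℝ) ≤ 1 / 2 := by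
    have h := (Rat.cast_le (K := ℝ)).2 hdS1; push_cast at h; exact h
  obtain ⟨δl, hδl0, hδld, hθl⟩ : ∃ δl : ℝ, 0 ≤ δl ∧ δl ≤ (((dS c) : ℚ) : ℝ) ∧
      ∀ t ∈ Set.Icc (Q : ℝ) P, (1 - δl) * t ≤ θ t := by
    by_cases h1423 : 1423 ≤ c.A₁.n
    · have hv : c.A₁.valid = true := hA₁.resolve_left (by omega)
      obtain ⟨hr, hr0⟩ := c.A₁.r_le_sqrt hv
      have hn₁r : (1423 : ℝ) ≤ c.A₁.n := by exact_mod_cast h1423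
      have hQ1423 : (1423 : ℝ) ≤ Q := hn₁r.trans hn₁Q
      have hsQ0 : 0 < √(Q : ℝ) := Real.sqrt_pos.2 hQ0
      refine ⟨1.95 / √(Q : ℝ), by positivity, ?_, sqrtWindow_lower hLo hQ1423 hPB⟩
      simp only [dS, if_pos h1423]; push_cast
      have hrQ : ((c.A₁.r : ℚ) : ℝ) ≤ √(Q : ℝ) := hr.trans (Real.sqrt_le_sqrt hn₁Q)
      rw [div_le_div_iff₀ hsQ0 (by positivity)]
      nlinarith
    · refine ⟨schoenfeldDelta Q, schoenfeldDelta_nonneg _, ?_, fun t ht =>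
        (theta_two_sidedW hW hQr ht.1 (ht.2.trans hPB)).1⟩
      simp only [dS, if_neg h1423]
      by_cases h : 599 ≤ c.A₁.n
      · have hv : c.A₁.valid = true := hA₁.resolve_left (not_lt.2 h)
        simp only [Cell.d1, if_pos h]
        exact (schoenfeldDelta_antitone (by exact_mod_cast h) hn₁Q).trans (c.A₁.delta_le hv)
      · simp only [Cell.d1, if_neg h, d599]
        have h1 := schoenfeldDelta_599_le
        have h2 := schoenfeldDelta_antitone (le_refl (599 : ℝ)) hQr
        push_cast; linarith
  have hθQl : (1 - δl) * (Q : ℝ) ≤ θ Q := hθl Q ⟨le_rfl, hQPr⟩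
  -- `G₂` from the two-parameter tail with `δ_u = 0`
  have hG : (1 - δl) * (Real.log Q / (Real.log Q + 1)) *
          (1 / ((Q : ℝ) * Real.log Q) - 1 / ((P : ℝ) * Real.log P)) - (δl + 0) / ((Q : ℝ) * Real.log Q) ≤
        ∑ p ∈ (Nat.primesLE P).filter (fun p => Q < p), ((p : ℝ) ^ 2)⁻¹ := by
    have h := le_sum_inv_sq₂ (Q := (Q : ℝ)) (P := (P : ℝ)) (δl := δl) (δu := 0) (by linarith) hQPr
      (by linarith) hθl hθQu
    rwa [Nat.floor_natCast, Nat.floor_natCast, ← filter_primesLE_eq] at h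
  -- enclosures
  have hℓ₁ : ((c.ell1 : ℚ) : ℝ) ≤ Real.log Q := by
    by_cases h : 599 ≤ c.A₁.n
    · have hv : c.A₁.valid = true := hA₁.resolve_left (not_lt.2 h)
      have hn0 : (0 : ℝ) < c.A₁.n := lt_of_lt_of_le (by norm_num) (show (599 : ℝ) ≤ c.A₁.n by exact_mod_cast h)
      simp only [Cell.ell1, if_pos h]
      exact (c.A₁.log_bounds hv).1.trans (Real.log_le_log hn0 hn₁Q)
    · simp only [Cell.ell1, if_neg h]
      exact ell599_le.trans (Real.log_le_log (by norm_num) hQr)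
  have hℓ₁0 : (0 : ℝ) < ((c.ell1 : ℚ) : ℝ) := by exact_mod_cast hell0
  have hL₁0 : (0 : ℝ) < ((L1 c.k : ℚ) : ℝ) := by linarith
  have hL₁P : ((L1 c.k : ℚ) : ℝ) ≤ Real.log P := hL₁.trans (Real.log_le_log (by positivity) hPl')
  have hs₁P : ((s1 c.k : ℚ) : ℝ) ≤ √(P : ℝ) := hs₁.trans (Real.sqrt_le_sqrt hPl')
  obtain ⟨hm0, hm⟩ := c.mlow_facts hA₂ hla hL₁0 ha₂0
  have hκ' : (0 : ℝ) ≤ (1 - (((dS c) : ℚ) : ℝ)) * (((c.ell1 : ℚ) : ℝ) / (((c.ell1 : ℚ) : ℝ) + 1)) -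
      ((((dS c) : ℚ) : ℝ) + 0) := by
    have : (0 : ℝ) ≤ (((kappaS c) : ℚ) : ℝ) := by exact_mod_cast hκS
    simp only [kappaS] at this; push_cast at this; linarith
  have hcR : (1 + (0 : ℝ)) + (1 + 0) * ((c.a2 : ℚ) : ℝ) / ((s1 c.k : ℚ) : ℝ) ≤ (((cRS c) : ℚ) : ℝ) := by
    simp only [cRS]; push_cast
    have e : (1 + (0 : ℝ)) + (1 + 0) * ((c.a2 : ℚ) : ℝ) / ((s1 c.k : ℚ) : ℝ) =
        1 + ((c.a2 : ℚ) : ℝ) / ((s1 c.k : ℚ) : ℝ) := by ring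
    exact le_of_eq e
  have hG2 := G2_mul_geA hQ hQP hG hδld hδl0 (le_refl (0 : ℝ)) hdS1r ha₂ ha₂0 hℓ₁ hℓ₁0 hL₁P hs₁P hs₁0 hm0 hm hκ'
  have hG1 := G1_mul_geA hQ hQP hθQl hθQu hθP1 hθPu hδld hδl0 hdS1r (le_refl (0 : ℝ)) (le_refl (0 : ℝ))
    (le_refl (0 : ℝ)) (le_refl (0 : ℝ)) ha₁ ha₂ ha₁0 ha₂0 hL₁P hL₁0 hs₁P hs₁0 hcR
  -- the box inequality, cast
  have hcell' : ((eBoxEbQ b c.k c.p16 : ℚ) : ℝ) <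
      g1Box ((dS c) : ℝ) (c.a1 : ℝ) ((cRS c) : ℝ) (L1 c.k : ℝ) + g2BoxA ((dS c) : ℝ) 0 (c.ell1 : ℝ) (c.mlow : ℝ) (s1 c.k : ℝ) := by
    rw [← g1BoxS_cast, ← g2BoxS_cast]; exact_mod_cast hcellB
  have hE := Eb_mul_le_levelBox hk hb0 hb2 hp0 hp6 hPl' hPu'
  have hsL : 0 < √(P : ℝ) * Real.log P := mul_pos (Real.sqrt_pos.2 hP0) (Real.log_pos (by linarith))
  have h : (nicolasERH P + ((b : ℝ) - nicolasBeta) * (1 / (√P * Real.log P) + 1 / (√P * Real.log P ^ 2) +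
      4 / (√P * Real.log P ^ 3))) * (√(P : ℝ) * Real.log P) <
      (∑ p ∈ (Nat.primesLE P).filter (fun p => Q < p), ((p : ℝ) ^ 2)⁻¹ +
        θ Q / ((θ P + θ Q) * Real.log (θ P + θ Q))) * (√(P : ℝ) * Real.log P) := by
    rw [add_mul]; linarith
  exact lt_of_mul_lt_mul_right h hsL.le

/-- **Soundness of `cellCheckFirstS`** (`Q ≤ 599`: the cell `[0, a₂√P]` at `Q' = 599` with `(δ_l, δ_u) = (d599, 0)`, `G₁ ≥ 0`). -/
theorem cell_soundFirstS {B : ℝ} (hW : ∀ y : ℝ, 599 ≤ y → y ≤ B → |θ y - y| ≤ √y * Real.log y ^ 2 / (8 * π))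
    (hUp : ∀ y : ℝ, 1 ≤ y → y ≤ B → θ y ≤ y)
    {b : ℚ} (hb0 : (0 : ℝ) ≤ b) (hb2 : (b : ℝ) ≤ 2.042)
    (c : Cell) (hc : cellCheckFirstS b c = true) (hn₂ : 599 ≤ c.A₂.n) {P Q : ℕ} (hPl : 4 ^ c.k ≤ P)
    (hPu : P ≤ 4 ^ (c.k + 1)) (hPB : (P : ℝ) ≤ B) (hQ : Q ≤ 599) :
    (nicolasERH P + ((b : ℝ) - nicolasBeta) * (1 / (√P * Real.log P) + 1 / (√P * Real.log P ^ 2) + 4 / (√P * Real.log P ^ 3))) <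
      ∑ p ∈ (Nat.primesLE P).filter (fun p => Q < p), ((p : ℝ) ^ 2)⁻¹ +
        θ Q / ((θ P + θ Q) * Real.log (θ P + θ Q)) := by
  simp only [cellCheckFirstS, Bool.and_eq_true, decide_eq_true_eq] at hc
  obtain ⟨hc, hcellB⟩ := hc
  simp only [Cell.checkFirst, Cell.check, Bool.and_eq_true, Bool.or_eq_true, decide_eq_true_eq,
    beq_iff_eq] at hc
  obtain ⟨⟨⟨⟨⟨⟨⟨⟨⟨⟨⟨⟨-, hA₂⟩, hn⟩, hk⟩, hp0⟩, hp6⟩, -⟩, -⟩, -⟩, hla⟩, -⟩, -⟩, -⟩ := hc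
  obtain ⟨hP₁599, hL₁, hU₁, hL₂, hL₁8, hs₁, hs₁0⟩ := range_facts hk
  have hPl' : (4 : ℝ) ^ c.k ≤ P := by exact_mod_cast hPl
  have hPu' : (P : ℝ) ≤ (4 : ℝ) ^ (c.k + 1) := by exact_mod_cast hPu
  have h2k : (0 : ℝ) < 2 ^ c.k := by positivity
  have hP599r : (599 : ℝ) ≤ P := hP₁599.trans hPl'
  have h599P : 599 ≤ P := by exact_mod_cast hP599r
  have hP0 : (0 : ℝ) < P := by linarith
  have hn₂r : (599 : ℝ) ≤ c.A₂.n := by exact_mod_cast hn₂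
  have ha₂0 : (0 : ℝ) < ((c.a2 : ℚ) : ℝ) := by simp only [Cell.a2]; push_cast; positivity
  have ha₂ : ((599 : ℕ) : ℝ) ≤ ((c.a2 : ℚ) : ℝ) * √(P : ℝ) := by
    simp only [Cell.a2]; push_cast
    have hsP : (2 : ℝ) ^ c.k ≤ √(P : ℝ) := by rw [← sqrt_four_pow]; exact Real.sqrt_le_sqrt hPl'
    rw [div_mul_eq_mul_div, le_div_iff₀ h2k]
    calc (599 : ℝ) * 2 ^ c.k ≤ c.A₂.n * 2 ^ c.k := by gcongr
      _ ≤ c.A₂.n * √(P : ℝ) := by gcongr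
  -- `θ`-facts at `599` and on `[599, P]`
  have hθl : ∀ t ∈ Set.Icc ((599 : ℕ) : ℝ) P, (1 - schoenfeldDelta ((599 : ℕ) : ℝ)) * t ≤ θ t := fun t ht =>
    (theta_two_sidedW hW (by norm_num) ht.1 (ht.2.trans hPB)).1
  have hθQu : θ ((599 : ℕ) : ℝ) ≤ (1 + 0) * ((599 : ℕ) : ℝ) := by
    rw [add_zero, one_mul]; exact hUp _ (by norm_num) (hP599r.trans hPB)
  have hG : (1 - schoenfeldDelta ((599 : ℕ) : ℝ)) * (Real.log ((599 : ℕ) : ℝ) / (Real.log ((599 : ℕ) : ℝ) + 1)) *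
          (1 / (((599 : ℕ) : ℝ) * Real.log ((599 : ℕ) : ℝ)) - 1 / ((P : ℝ) * Real.log P)) -
          (schoenfeldDelta ((599 : ℕ) : ℝ) + 0) / (((599 : ℕ) : ℝ) * Real.log ((599 : ℕ) : ℝ)) ≤
        ∑ p ∈ (Nat.primesLE P).filter (fun p => 599 < p), ((p : ℝ) ^ 2)⁻¹ := by
    have h := le_sum_inv_sq₂ (Q := ((599 : ℕ) : ℝ)) (P := (P : ℝ)) (δl := schoenfeldDelta ((599 : ℕ) : ℝ))
      (δu := 0) (by norm_num) (by exact_mod_cast h599P) ((schoenfeldDelta_le (by norm_num)).trans (by norm_num)) hθl hθQu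
    rwa [Nat.floor_natCast, Nat.floor_natCast, ← filter_primesLE_eq] at h
  have hd : schoenfeldDelta ((599 : ℕ) : ℝ) ≤ ((d599 : ℚ) : ℝ) := by
    have := schoenfeldDelta_599_le; simp only [d599]; push_cast; exact_mod_cast this
  have hd1 : ((d599 : ℚ) : ℝ) ≤ 1 / 2 := by simp only [d599]; push_cast; norm_num
  have hℓ₁ : ((ell599 : ℚ) : ℝ) ≤ Real.log ((599 : ℕ) : ℝ) := by push_cast; exact ell599_le
  have hℓ₁0 : (0 : ℝ) < ((ell599 : ℚ) : ℝ) := by simp only [ell599, l2, l3]; push_cast; norm_num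
  have hL₁0 : (0 : ℝ) < ((L1 c.k : ℚ) : ℝ) := by linarith
  have hL₁P : ((L1 c.k : ℚ) : ℝ) ≤ Real.log P := hL₁.trans (Real.log_le_log (by positivity) hPl')
  have hs₁P : ((s1 c.k : ℚ) : ℝ) ≤ √(P : ℝ) := hs₁.trans (Real.sqrt_le_sqrt hPl')
  obtain ⟨hm0, hm⟩ := c.mlow_facts hA₂ hla hL₁0 ha₂0
  have hG2 := G2_mul_geA (Q := 599) (P := P) le_rfl h599P hG hd (schoenfeldDelta_nonneg _) (le_refl (0 : ℝ)) hd1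
    ha₂ ha₂0 hℓ₁ hℓ₁0 hL₁P hs₁P hs₁0 hm0 hm kappaFirstS_nonneg
  have hcell' : ((eBoxEbQ b c.k c.p16 : ℚ) : ℝ) < g2BoxA (d599 : ℝ) 0 (ell599 : ℝ) (c.mlow : ℝ) (s1 c.k : ℝ) := by
    rw [← g2BoxFirstS_cast]; exact_mod_cast hcellB
  have hE := Eb_mul_le_levelBox hk hb0 hb2 hp0 hp6 hPl' hPu'
  have hS' := sum_filter_antitone (P := P) hQ
  have hG0 : 0 ≤ θ Q / ((θ P + θ Q) * Real.log (θ P + θ Q)) := by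
    have h1 : 0 ≤ θ (Q : ℝ) := Chebyshev.theta_nonneg _
    have h2 : 1 ≤ θ (P : ℝ) := one_le_theta_ofW hW hP599r hPB
    have h3 : 0 ≤ Real.log (θ P + θ Q) := Real.log_nonneg (by linarith)
    positivity
  have hsL : 0 < √(P : ℝ) * Real.log P := mul_pos (Real.sqrt_pos.2 hP0) (Real.log_pos (by linarith))
  have h : (nicolasERH P + ((b : ℝ) - nicolasBeta) * (1 / (√P * Real.log P) + 1 / (√P * Real.log P ^ 2) +
      4 / (√P * Real.log P ^ 3))) * (√(P : ℝ) * Real.log P) <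
      (∑ p ∈ (Nat.primesLE P).filter (fun p => 599 < p), ((p : ℝ) ^ 2)⁻¹) * (√(P : ℝ) * Real.log P) := by
    linarith
  have h' := lt_of_mul_lt_mul_right h hsL.le
  linarith

end SqrtWindowCells

end Summit.RiemannHypothesis.RiemannHypothesis.Theorems.Splittings.RobinFiniteC1

end
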